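import Mathlib
import HarnessLib
import Summits.HubbardSuperconductivity.HubbardSuperconductivity.Theorems.KLProgrammeKLRegimeTwoVolumeTowerBaseGridBound

/-!
# Route `KLProgramme` — crux K3, VL child `KLRegimeVolumeLimitV17F2` (stmt-HubbardSuperconductivity-20440), blueprint v5 M5 / W4d (arithmetic, SCALED form):
# THE RIGHT-HAND SIDE OF THE GRID BASE DEFECT IS `ε ×` RATE-WEIGHTED CONSTANTS WHEN COVARIANCE ROWS SCALE AS `1/ε` (seat hubbard-kl-k3c4-p1 g13; `--supports` 20440)

`…TowerBaseGridBound.tower_base_grid_rhs_le_eps_mul` assumed volume-free ROW constants.  On the grid the covariance `S_Vᵀ C^K_{>Λ} S_V` has `O(1)` entries,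
Gram constant and SECTIONAL tails, but its row / column sums, moments and all-times tails carry the factor `N/β = 2/ε`
(`…TwoVolumeTopFrameGridDataAt.rowWt_uvCovAt_le`), while kernel profiles carry `ε`.  This file re-does the bookkeeping in that scaling: the
per-instance row-type numbers `αC, cR + cC, αw, α' + α + (m₁' + m₁), T` enter only through the products `ε·αC ≤ aC`, `ε·(cR + cC) ≤ cc`, `ε·αw ≤ aw`,
`ε·(α' + α + (m₁' + m₁)) ≤ A`, `ε·T ≤ tT`, and the profile-type numbers through `normV ≤ ε·ν̄`; every summand is then `ε ×` (a rate among
`sE, cc, eE, (1+R)/(R′+2), Te, tT, (R′+1)⁻¹`) `×` a volume-free constant.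

* **`tower_base_grid_rhs_le_eps_mul_scaled`**.

Proofs only; no definition.
-/

noncomputable section

namespace Summit.HubbardSuperconductivity.HubbardSuperconductivity.Theorems.TwoVolumeSource

set_option linter.dupNamespace false -- summit = problem name (single-conjunct summit), D-0017

open Finset Literature.MathematicalPhysics.QuantumLattice
open Summit.HubbardSuperconductivity.HubbardSuperconductivity.Theorems.TwoVolumeDefect

set_option maxHeartbeats 800000 in -- long but elementary real arithmetic
/-- **THE RIGHT-HAND SIDE OF THE GRID BASE DEFECT IS `ε ×` A SUM OF RATE-WEIGHTED VOLUME-FREE CONSTANTS, in the grid scaling** (rows `∝ 1/ε`, profiles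
`∝ ε`; see the module docstring). [folklore] -/
theorem tower_base_grid_rhs_le_eps_mul_scaled (Γ : Type) [Fintype Γ] (n : ℕ) {ε : ℝ} (hε : 0 ≤ ε)
    -- frame-swap part
    {sE cR cC cc aC cb αC κE ρS νW : ℝ} {NW : ℕ → ℝ} (hsE : 0 ≤ sE) (hcR : 0 ≤ cR) (hcC : 0 ≤ cC) (hcc : ε * (cR + cC) ≤ cc) (hccb : cc ≤ cb)
    (hαC : 0 ≤ αC) (hαCε : ε * αC ≤ aC) (hκE : 0 < κE)
    (hρS : 0 < ρS) (hNW0 : ∀ m', 0 ≤ NW m') (hνW0 : 0 ≤ νW) (hνW : normV Γ κE ρS NW ≤ ε * νW) (hθS : Real.exp 1 * (aC + cb) * νW / κE ^ 2 < 1)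
    -- M4a part
    {κ κ' ρ' ρ₂ ρf αw aw α α' m₁ m₁' A s s' T tT Te νEbar eE νD Θ νf ν₂ : ℝ} {Nw NV ND E : ℕ → ℝ} (R R' : ℕ)
    (hκ : 0 < κ) (hκ' : 0 < κ') (hρ' : 0 < ρ') (hρ₂ : 0 < ρ₂) (hρf : 0 < ρf) (hαw : 0 ≤ αw) (hαwε : ε * αw ≤ aw) (hαα : 0 ≤ α' + α) (hm : 0 ≤ m₁' + m₁)
    (hAε : ε * (α' + α + (m₁' + m₁)) ≤ A) (hss : 0 ≤ s' + s)
    (hT : 0 ≤ T) (htT : ε * T ≤ tT) (hTe : 0 ≤ Te) (hNw0 : ∀ m', 0 ≤ Nw m') (hND0 : ∀ m', 0 ≤ ND m') (hE0 : ∀ m', 0 ≤ E m')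
    (heE : normV Γ κ' ρ' E ≤ ε * eE) (hνD : normV Γ κ' ρ' ND ≤ ε * ((1 + (R : ℝ)) * νD))
    (hΘ1 : normV Γ κ' ρ' (fun m' => NV m' + ND m') + νEbar ≤ ε * Θ) (hΘ2 : normV Γ κ' ρ' NV + normV Γ κ' ρ' ND ≤ ε * Θ) (hΘ0 : 0 ≤ Θ)
    (hθΘ : Real.exp 1 * aw * Θ / κ' ^ 2 < 1)
    (hνf0 : 0 ≤ νf) (hνf : normV Γ (κ' + κ) ρf Nw ≤ ε * νf) (hθf : Real.exp 1 * A * νf / (κ' + κ) ^ 2 < 1)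
    (hν₂0 : 0 ≤ ν₂) (hν₂ : normV Γ (κ' + κ + (κ' + κ + (κ' + κ))) ρ₂ Nw ≤ ε * ν₂)
    (hθ₂ : Real.exp 1 * A * ν₂ / (κ' + κ + (κ' + κ + (κ' + κ))) ^ 2 < 1) :
      (((((n + 1 + 1) * (n + 1 + 2) : ℕ) : ℝ) / 2 * sE *
          (ρS⁻¹ ^ (n + 3) * (Real.exp 1 * normV (Γ) κE ρS NW) /
            (1 - Real.exp 1 * (αC + (cR + cC)) * normV (Γ) κE ρS NW / κE ^ 2)) +
        ‖(2 : ℂ)⁻¹‖ * ∑ a' ∈ range (n + 2), ∑ b' ∈ range (n + 2),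
          (if a' + b' = n + 1 then (((a' + 1) * (b' + 1) : ℕ) : ℝ) *
            (cR * (ρS⁻¹ ^ (a' + 1) * (Real.exp 1 * normV (Γ) κE ρS NW) /
                  (1 - Real.exp 1 * (αC + (cR + cC)) * normV (Γ) κE ρS NW / κE ^ 2)) *
                (ρS⁻¹ ^ (b' + 1) * (Real.exp 1 * normV (Γ) κE ρS NW) /
                  (1 - Real.exp 1 * (αC + (cR + cC)) * normV (Γ) κE ρS NW / κE ^ 2)) +
              cC * (ρS⁻¹ ^ (a' + 1) * (Real.exp 1 * normV (Γ) κE ρS NW) /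
                  (1 - Real.exp 1 * (αC + (cR + cC)) * normV (Γ) κE ρS NW / κE ^ 2)) *
                (ρS⁻¹ ^ (b' + 1) * (Real.exp 1 * normV (Γ) κE ρS NW) /
                  (1 - Real.exp 1 * (αC + (cR + cC)) * normV (Γ) κE ρS NW / κE ^ 2))) else 0))) +
      ((ρ'⁻¹ ^ (n + 1) * Real.exp 1 / (1 - Real.exp 1 * αw * (normV (Γ) κ' ρ' (fun m' => NV m' + ND m') + νEbar) / κ' ^ 2) ^ 2) * normV (Γ) κ' ρ' E +
        (ρ'⁻¹ ^ (n + 1) * (Real.exp 1 * normV (Γ) κ' ρ' ND) / (1 - Real.exp 1 * αw * (normV (Γ) κ' ρ' NV + normV (Γ) κ' ρ' ND) / κ' ^ 2) ^ 2) * (1 + ((R' : ℝ) + 1))⁻¹ +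
        ((((n + 1 + 1) * (n + 1 + 2) : ℕ) : ℝ) / 2 *
            (ρ₂⁻¹ ^ (n + 3) * (Real.exp 1 * normV (Γ) (κ' + κ + (κ' + κ + (κ' + κ))) ρ₂ Nw) / (1 - Real.exp 1 * (α' + α + (m₁' + m₁)) * normV (Γ) (κ' + κ + (κ' + κ + (κ' + κ))) ρ₂ Nw / (κ' + κ + (κ' + κ + (κ' + κ))) ^ 2))) * Te +
        (‖(2 : ℂ)⁻¹‖ * ∑ a ∈ range (n + 2), ∑ b' ∈ range (n + 2),
            (if a + b' = n + 1 then (((a + 1) * (b' + 1) : ℕ) : ℝ) *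
              (4 * (ρ₂⁻¹ ^ (a + 1) * (Real.exp 1 * normV (Γ) (κ' + κ + (κ' + κ + (κ' + κ))) ρ₂ Nw) / (1 - Real.exp 1 * (α' + α + (m₁' + m₁)) * normV (Γ) (κ' + κ + (κ' + κ + (κ' + κ))) ρ₂ Nw / (κ' + κ + (κ' + κ + (κ' + κ))) ^ 2)) *
                (ρ₂⁻¹ ^ (b' + 1) * (Real.exp 1 * normV (Γ) (κ' + κ + (κ' + κ + (κ' + κ))) ρ₂ Nw) / (1 - Real.exp 1 * (α' + α + (m₁' + m₁)) * normV (Γ) (κ' + κ + (κ' + κ + (κ' + κ))) ρ₂ Nw / (κ' + κ + (κ' + κ + (κ' + κ))) ^ 2))) else 0)) * T +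
        ((((n + 1 + 1) * (n + 1 + 2) : ℕ) : ℝ) / 2 * (s' + s) *
              (ρf⁻¹ ^ (n + 3) * (Real.exp 1 * normV (Γ) (κ' + κ) ρf Nw) / (1 - Real.exp 1 * (α' + α + (m₁' + m₁)) * normV (Γ) (κ' + κ) ρf Nw / (κ' + κ) ^ 2)) +
            ‖(2 : ℂ)⁻¹‖ * ∑ a ∈ range (n + 2), ∑ b' ∈ range (n + 2),
              (if a + b' = n + 1 then (((a + 1) * (b' + 1) : ℕ) : ℝ) *
                (2 * (α' + α) * (ρf⁻¹ ^ (a + 1) * (Real.exp 1 * normV (Γ) (κ' + κ) ρf Nw) / (1 - Real.exp 1 * (α' + α + (m₁' + m₁)) * normV (Γ) (κ' + κ) ρf Nw / (κ' + κ) ^ 2)) *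
                  (ρf⁻¹ ^ (b' + 1) * (Real.exp 1 * normV (Γ) (κ' + κ) ρf Nw) / (1 - Real.exp 1 * (α' + α + (m₁' + m₁)) * normV (Γ) (κ' + κ) ρf Nw / (κ' + κ) ^ 2))) else 0)) * ((R' : ℝ) + 1)⁻¹) ≤
      ε * (sE * (((((n + 1 + 1) * (n + 1 + 2) : ℕ) : ℝ) / 2) * (ρS⁻¹ ^ (n + 3) * (Real.exp 1 * νW) / (1 - Real.exp 1 * (aC + cb) * νW / κE ^ 2))) +
        cc * (‖(2 : ℂ)⁻¹‖ * ∑ a' ∈ range (n + 2), ∑ b' ∈ range (n + 2), (if a' + b' = n + 1 then (((a' + 1) * (b' + 1) : ℕ) : ℝ) * ((ρS⁻¹ ^ (a' + 1) * (Real.exp 1 * νW) / (1 - Real.exp 1 * (aC + cb) * νW / κE ^ 2)) * (ρS⁻¹ ^ (b' + 1) * (Real.exp 1 * νW) / (1 - Real.exp 1 * (aC + cb) * νW / κE ^ 2))) else 0)) +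
        eE * (ρ'⁻¹ ^ (n + 1) * Real.exp 1 / (1 - Real.exp 1 * aw * Θ / κ' ^ 2) ^ 2) +
        (1 + (R : ℝ)) / (1 + ((R' : ℝ) + 1)) * (ρ'⁻¹ ^ (n + 1) * (Real.exp 1 * νD) / (1 - Real.exp 1 * aw * Θ / κ' ^ 2) ^ 2) +
        Te * (((((n + 1 + 1) * (n + 1 + 2) : ℕ) : ℝ) / 2) * (ρ₂⁻¹ ^ (n + 3) * (Real.exp 1 * ν₂) / (1 - Real.exp 1 * A * ν₂ / (κ' + κ + (κ' + κ + (κ' + κ))) ^ 2))) +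
        tT * (‖(2 : ℂ)⁻¹‖ * ∑ a ∈ range (n + 2), ∑ b' ∈ range (n + 2), (if a + b' = n + 1 then (((a + 1) * (b' + 1) : ℕ) : ℝ) * (4 * (ρ₂⁻¹ ^ (a + 1) * (Real.exp 1 * ν₂) / (1 - Real.exp 1 * A * ν₂ / (κ' + κ + (κ' + κ + (κ' + κ))) ^ 2)) * (ρ₂⁻¹ ^ (b' + 1) * (Real.exp 1 * ν₂) / (1 - Real.exp 1 * A * ν₂ / (κ' + κ + (κ' + κ + (κ' + κ))) ^ 2))) else 0)) +
        ((R' : ℝ) + 1)⁻¹ * (((((n + 1 + 1) * (n + 1 + 2) : ℕ) : ℝ) / 2) * (s' + s) * (ρf⁻¹ ^ (n + 3) * (Real.exp 1 * νf) / (1 - Real.exp 1 * A * νf / (κ' + κ) ^ 2)) + ‖(2 : ℂ)⁻¹‖ * ∑ a ∈ range (n + 2), ∑ b' ∈ range (n + 2), (if a + b' = n + 1 then (((a + 1) * (b' + 1) : ℕ) : ℝ) * (2 * A * (ρf⁻¹ ^ (a + 1) * (Real.exp 1 * νf) / (1 - Real.exp 1 * A * νf / (κ' + κ) ^ 2)) *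 (ρf⁻¹ ^ (b' + 1) * (Real.exp 1 * νf) / (1 - Real.exp 1 * A * νf / (κ' + κ) ^ 2))) else 0))) := by
  have he0 : 0 < Real.exp 1 := Real.exp_pos 1
  have hcb0 : 0 ≤ cb := le_trans (le_trans (mul_nonneg hε (add_nonneg hcR hcC)) hcc) hccb
  have haC0 : 0 ≤ aC := le_trans (mul_nonneg hε hαC) hαCε
  have haw0 : 0 ≤ aw := le_trans (mul_nonneg hε hαw) hαwε
  have hA0 : 0 ≤ A := le_trans (mul_nonneg hε (add_nonneg hαα hm)) hAε
  have hAα : ε * (α' + α) ≤ A := le_trans (mul_le_mul_of_nonneg_left (le_add_of_nonneg_right hm) hε) hAε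
  -- §A the frame-swap blocks
  have hXW0 : 0 ≤ normV Γ κE ρS NW := normV_nonneg hκE.le hρS.le hNW0
  have hθSi : Real.exp 1 * (αC + (cR + cC)) * normV Γ κE ρS NW / κE ^ 2 ≤ Real.exp 1 * (aC + cb) * νW / κE ^ 2 := by
    refine div_le_div_of_nonneg_right ?_ (sq_nonneg _)
    calc Real.exp 1 * (αC + (cR + cC)) * normV Γ κE ρS NW ≤ Real.exp 1 * (αC + (cR + cC)) * (ε * νW) :=
          mul_le_mul_of_nonneg_left hνW (mul_nonneg he0.le (add_nonneg hαC (add_nonneg hcR hcC)))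
      _ = Real.exp 1 * (ε * αC + ε * (cR + cC)) * νW := by ring
      _ ≤ Real.exp 1 * (aC + cb) * νW := mul_le_mul_of_nonneg_right (mul_le_mul_of_nonneg_left (add_le_add hαCε (hcc.trans hccb)) he0.le) hνW0
  have hGS : ∀ j : ℕ, (ρS⁻¹ ^ (j) * (Real.exp 1 * normV Γ κE ρS NW) / (1 - Real.exp 1 * (αC + (cR + cC)) * normV Γ κE ρS NW / κE ^ 2)) ≤ ε * (ρS⁻¹ ^ (j) * (Real.exp 1 * νW) / (1 - Real.exp 1 * (aC + cb) * νW / κE ^ 2)) := fun j => towerBase_geomBlock_le j hρS hXW0 hνW hθSi hθS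
  have hGS0 : ∀ j : ℕ, 0 ≤ (ρS⁻¹ ^ (j) * (Real.exp 1 * νW) / (1 - Real.exp 1 * (aC + cb) * νW / κE ^ 2)) := fun j => div_nonneg (by positivity) (sub_pos.2 hθS).le
  have hGSi0 : ∀ j : ℕ, 0 ≤ (ρS⁻¹ ^ (j) * (Real.exp 1 * normV Γ κE ρS NW) / (1 - Real.exp 1 * (αC + (cR + cC)) * normV Γ κE ρS NW / κE ^ 2)) := fun j => div_nonneg (by positivity) (by linarith)
  -- term 1
  have h1 : ((((n + 1 + 1) * (n + 1 + 2) : ℕ) : ℝ) / 2) * sE * (ρS⁻¹ ^ (n + 3) * (Real.exp 1 * normV Γ κE ρS NW) / (1 - Real.exp 1 * (αC + (cR + cC)) * normV Γ κE ρS NW / κE ^ 2)) ≤ ε * (sE * (((((n + 1 + 1) * (n + 1 + 2) : ℕ) : ℝ) / 2) * (ρS⁻¹ ^ (n + 3) * (Real.exp 1 * νW) / (1 - Real.exp 1 * (aC + cb) * νW / κE ^ 2)))) :=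
    calc ((((n + 1 + 1) * (n + 1 + 2) : ℕ) : ℝ) / 2) * sE * (ρS⁻¹ ^ (n + 3) * (Real.exp 1 * normV Γ κE ρS NW) / (1 - Real.exp 1 * (αC + (cR + cC)) * normV Γ κE ρS NW / κE ^ 2)) ≤ ((((n + 1 + 1) * (n + 1 + 2) : ℕ) : ℝ) / 2) * sE * (ε * (ρS⁻¹ ^ (n + 3) * (Real.exp 1 * νW) / (1 - Real.exp 1 * (aC + cb) * νW / κE ^ 2))) := mul_le_mul_of_nonneg_left (hGS _) (by positivity)
      _ = ε * (sE * (((((n + 1 + 1) * (n + 1 + 2) : ℕ) : ℝ) / 2) * (ρS⁻¹ ^ (n + 3) * (Real.exp 1 * νW) / (1 - Real.exp 1 * (aC + cb) * νW / κE ^ 2)))) := by ring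
  -- term 2
  have h2 : ‖(2 : ℂ)⁻¹‖ * ∑ a' ∈ range (n + 2), ∑ b' ∈ range (n + 2),
      (if a' + b' = n + 1 then (((a' + 1) * (b' + 1) : ℕ) : ℝ) * (cR * (ρS⁻¹ ^ (a' + 1) * (Real.exp 1 * normV Γ κE ρS NW) / (1 - Real.exp 1 * (αC + (cR + cC)) * normV Γ κE ρS NW / κE ^ 2)) * (ρS⁻¹ ^ (b' + 1) * (Real.exp 1 * normV Γ κE ρS NW) / (1 - Real.exp 1 * (αC + (cR + cC)) * normV Γ κE ρS NW / κE ^ 2)) + cC * (ρS⁻¹ ^ (a' + 1) * (Real.exp 1 * normV Γ κE ρS NW) / (1 - Real.exp 1 * (αC + (cR + cC)) * normV Γ κE ρS NW / κE ^ 2)) * (ρS⁻¹ ^ (b' + 1) * (Real.exp 1 * normV Γ κE ρS NW) / (1 - Real.exp 1 * (αC + (cR + cC)) * normV Γ κE ρS NW / κE ^ 2))) else 0) ≤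
      ε * (cc * (‖(2 : ℂ)⁻¹‖ * ∑ a' ∈ range (n + 2), ∑ b' ∈ range (n + 2), (if a' + b' = n + 1 then (((a' + 1) * (b' + 1) : ℕ) : ℝ) * ((ρS⁻¹ ^ (a' + 1) * (Real.exp 1 * νW) / (1 - Real.exp 1 * (aC + cb) * νW / κE ^ 2)) * (ρS⁻¹ ^ (b' + 1) * (Real.exp 1 * νW) / (1 - Real.exp 1 * (aC + cb) * νW / κE ^ 2))) else 0))) := by
    have hs : ∑ a' ∈ range (n + 2), ∑ b' ∈ range (n + 2),
        (if a' + b' = n + 1 then (((a' + 1) * (b' + 1) : ℕ) : ℝ) * (cR * (ρS⁻¹ ^ (a' + 1) * (Real.exp 1 * normV Γ κE ρS NW) / (1 - Real.exp 1 * (αC + (cR + cC)) * normV Γ κE ρS NW / κE ^ 2)) * (ρS⁻¹ ^ (b' + 1) * (Real.exp 1 * normV Γ κE ρS NW) / (1 - Real.exp 1 * (αC + (cR + cC)) * normV Γ κE ρS NW / κE ^ 2)) + cC * (ρS⁻¹ ^ (a' + 1) * (Real.exp 1 * normV Γ κE ρS NW) / (1 - Real.exp 1 * (αC + (cR + cC))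 * normV Γ κE ρS NW / κE ^ 2)) * (ρS⁻¹ ^ (b' + 1) * (Real.exp 1 * normV Γ κE ρS NW) / (1 - Real.exp 1 * (αC + (cR + cC)) * normV Γ κE ρS NW / κE ^ 2))) else 0) ≤
        ∑ a' ∈ range (n + 2), ∑ b' ∈ range (n + 2), ε * cc *
          (if a' + b' = n + 1 then (((a' + 1) * (b' + 1) : ℕ) : ℝ) * ((ρS⁻¹ ^ (a' + 1) * (Real.exp 1 * νW) / (1 - Real.exp 1 * (aC + cb) * νW / κE ^ 2)) * (ρS⁻¹ ^ (b' + 1) * (Real.exp 1 * νW) / (1 - Real.exp 1 * (aC + cb) * νW / κE ^ 2))) else 0) := by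
      refine sum_le_sum fun a' _ => sum_le_sum fun b' _ => ?_
      split_ifs
      · have hP : (ρS⁻¹ ^ (a' + 1) * (Real.exp 1 * normV Γ κE ρS NW) / (1 - Real.exp 1 * (αC + (cR + cC)) * normV Γ κE ρS NW / κE ^ 2)) * (ρS⁻¹ ^ (b' + 1) * (Real.exp 1 * normV Γ κE ρS NW) / (1 - Real.exp 1 * (αC + (cR + cC)) * normV Γ κE ρS NW / κE ^ 2)) ≤ (ε * (ρS⁻¹ ^ (a' + 1) * (Real.exp 1 * νW) / (1 - Real.exp 1 * (aC + cb) * νW / κE ^ 2))) * (ε * (ρS⁻¹ ^ (b' + 1) * (Real.exp 1 * νW) / (1 - Real.exp 1 * (aC + cb) * νW / κE ^ 2))) :=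
          mul_le_mul (hGS _) (hGS _) (hGSi0 _) (mul_nonneg hε (hGS0 _))
        have hA' : (0 : ℝ) ≤ (((a' + 1) * (b' + 1) : ℕ) : ℝ) := by positivity
        have hG2' : 0 ≤ (ρS⁻¹ ^ (a' + 1) * (Real.exp 1 * νW) / (1 - Real.exp 1 * (aC + cb) * νW / κE ^ 2)) * (ρS⁻¹ ^ (b' + 1) * (Real.exp 1 * νW) / (1 - Real.exp 1 * (aC + cb) * νW / κE ^ 2)) := mul_nonneg (hGS0 _) (hGS0 _)
        calc (((a' + 1) * (b' + 1) : ℕ) : ℝ) * (cR * (ρS⁻¹ ^ (a' + 1) * (Real.exp 1 * normV Γ κE ρS NW) / (1 - Real.exp 1 * (αC + (cR + cC)) * normV Γ κE ρS NW / κE ^ 2)) * (ρS⁻¹ ^ (b' + 1) * (Real.exp 1 * normV Γ κE ρS NW) / (1 - Real.exp 1 * (αC + (cR + cC)) * normV Γ κE ρS NW / κE ^ 2)) + cC * (ρS⁻¹ ^ (a' + 1) * (Real.exp 1 * normV Γ κE ρS NW) / (1 - Real.exp 1 * (αC + (cR + cC)) * normV Γ κE ρS NW / κE ^ 2)) * (ρS⁻¹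 ^ (b' + 1) * (Real.exp 1 * normV Γ κE ρS NW) / (1 - Real.exp 1 * (αC + (cR + cC)) * normV Γ κE ρS NW / κE ^ 2)))
            = (cR + cC) * ((((a' + 1) * (b' + 1) : ℕ) : ℝ) * ((ρS⁻¹ ^ (a' + 1) * (Real.exp 1 * normV Γ κE ρS NW) / (1 - Real.exp 1 * (αC + (cR + cC)) * normV Γ κE ρS NW / κE ^ 2)) * (ρS⁻¹ ^ (b' + 1) * (Real.exp 1 * normV Γ κE ρS NW) / (1 - Real.exp 1 * (αC + (cR + cC)) * normV Γ κE ρS NW / κE ^ 2)))) := by ring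
          _ ≤ (cR + cC) * ((((a' + 1) * (b' + 1) : ℕ) : ℝ) * ((ε * (ρS⁻¹ ^ (a' + 1) * (Real.exp 1 * νW) / (1 - Real.exp 1 * (aC + cb) * νW / κE ^ 2))) * (ε * (ρS⁻¹ ^ (b' + 1) * (Real.exp 1 * νW) / (1 - Real.exp 1 * (aC + cb) * νW / κE ^ 2))))) :=
            mul_le_mul_of_nonneg_left (mul_le_mul_of_nonneg_left hP hA') (add_nonneg hcR hcC)
          _ = ε * (ε * (cR + cC)) * ((((a' + 1) * (b' + 1) : ℕ) : ℝ) * ((ρS⁻¹ ^ (a' + 1) * (Real.exp 1 * νW) / (1 - Real.exp 1 * (aC + cb) * νW / κE ^ 2)) * (ρS⁻¹ ^ (b' + 1) * (Real.exp 1 * νW) / (1 - Real.exp 1 * (aC + cb) * νW / κE ^ 2)))) := by ring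
          _ ≤ ε * cc * ((((a' + 1) * (b' + 1) : ℕ) : ℝ) * ((ρS⁻¹ ^ (a' + 1) * (Real.exp 1 * νW) / (1 - Real.exp 1 * (aC + cb) * νW / κE ^ 2)) * (ρS⁻¹ ^ (b' + 1) * (Real.exp 1 * νW) / (1 - Real.exp 1 * (aC + cb) * νW / κE ^ 2)))) :=
            mul_le_mul_of_nonneg_right (mul_le_mul_of_nonneg_left hcc hε) (mul_nonneg hA' hG2')
      · rw [mul_zero]
    simp_rw [← Finset.mul_sum] at hs
    calc ‖(2 : ℂ)⁻¹‖ * _ ≤ ‖(2 : ℂ)⁻¹‖ * (ε * cc * ∑ a' ∈ range (n + 2), ∑ b' ∈ range (n + 2),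
          (if a' + b' = n + 1 then (((a' + 1) * (b' + 1) : ℕ) : ℝ) * ((ρS⁻¹ ^ (a' + 1) * (Real.exp 1 * νW) / (1 - Real.exp 1 * (aC + cb) * νW / κE ^ 2)) * (ρS⁻¹ ^ (b' + 1) * (Real.exp 1 * νW) / (1 - Real.exp 1 * (aC + cb) * νW / κE ^ 2))) else 0)) :=
        mul_le_mul_of_nonneg_left hs (norm_nonneg _)
      _ = ε * (cc * (‖(2 : ℂ)⁻¹‖ * ∑ a' ∈ range (n + 2), ∑ b' ∈ range (n + 2), (if a' + b' = n + 1 then (((a' + 1) * (b' + 1) : ℕ) : ℝ) * ((ρS⁻¹ ^ (a' + 1) * (Real.exp 1 * νW) / (1 - Real.exp 1 * (aC + cb) * νW / κE ^ 2)) * (ρS⁻¹ ^ (b' + 1) * (Real.exp 1 * νW) / (1 - Real.exp 1 * (aC + cb) * νW / κE ^ 2))) else 0))) := by ring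
  -- §B M4a's blocks
  have hθ1i : Real.exp 1 * αw * (normV Γ κ' ρ' (fun m' => NV m' + ND m') + νEbar) / κ' ^ 2 ≤ Real.exp 1 * aw * Θ / κ' ^ 2 := by
    refine div_le_div_of_nonneg_right ?_ (sq_nonneg _)
    calc Real.exp 1 * αw * (normV Γ κ' ρ' (fun m' => NV m' + ND m') + νEbar) ≤ Real.exp 1 * αw * (ε * Θ) :=
          mul_le_mul_of_nonneg_left hΘ1 (by positivity)
      _ = Real.exp 1 * (ε * αw) * Θ := by ring
      _ ≤ Real.exp 1 * aw * Θ := mul_le_mul_of_nonneg_right (mul_le_mul_of_nonneg_left hαwε he0.le) hΘ0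
  have hθ2i : Real.exp 1 * αw * (normV Γ κ' ρ' NV + normV Γ κ' ρ' ND) / κ' ^ 2 ≤ Real.exp 1 * aw * Θ / κ' ^ 2 := by
    refine div_le_div_of_nonneg_right ?_ (sq_nonneg _)
    calc Real.exp 1 * αw * (normV Γ κ' ρ' NV + normV Γ κ' ρ' ND) ≤ Real.exp 1 * αw * (ε * Θ) :=
          mul_le_mul_of_nonneg_left hΘ2 (by positivity)
      _ = Real.exp 1 * (ε * αw) * Θ := by ring
      _ ≤ Real.exp 1 * aw * Θ := mul_le_mul_of_nonneg_right (mul_le_mul_of_nonneg_left hαwε he0.le) hΘ0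
  have hA3_0 : 0 ≤ (ρ'⁻¹ ^ (n + 1) * Real.exp 1 / (1 - Real.exp 1 * aw * Θ / κ' ^ 2) ^ 2) := div_nonneg (by positivity) (sq_nonneg _)
  -- term 3
  have h3 : ρ'⁻¹ ^ (n + 1) * Real.exp 1 / (1 - Real.exp 1 * αw * (normV Γ κ' ρ' (fun m' => NV m' + ND m') + νEbar) / κ' ^ 2) ^ 2 * normV Γ κ' ρ' E ≤ ε * (eE * (ρ'⁻¹ ^ (n + 1) * Real.exp 1 / (1 - Real.exp 1 * aw * Θ / κ' ^ 2) ^ 2)) :=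
    calc ρ'⁻¹ ^ (n + 1) * Real.exp 1 / (1 - Real.exp 1 * αw * (normV Γ κ' ρ' (fun m' => NV m' + ND m') + νEbar) / κ' ^ 2) ^ 2 * normV Γ κ' ρ' E ≤ (ρ'⁻¹ ^ (n + 1) * Real.exp 1 / (1 - Real.exp 1 * aw * Θ / κ' ^ 2) ^ 2) * (ε * eE) :=
          mul_le_mul (towerBase_geomCoefSq_le (n + 1) hρ' hθ1i hθΘ) heE (normV_nonneg hκ'.le hρ'.le hE0) hA3_0
      _ = ε * (eE * (ρ'⁻¹ ^ (n + 1) * Real.exp 1 / (1 - Real.exp 1 * aw * Θ / κ' ^ 2) ^ 2)) := by ring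
  -- term 4
  have h4 : ρ'⁻¹ ^ (n + 1) * (Real.exp 1 * normV Γ κ' ρ' ND) / (1 - Real.exp 1 * αw * (normV Γ κ' ρ' NV + normV Γ κ' ρ' ND) / κ' ^ 2) ^ 2 * (1 + ((R' : ℝ) + 1))⁻¹ ≤
      ε * ((1 + (R : ℝ)) / (1 + ((R' : ℝ) + 1)) * (ρ'⁻¹ ^ (n + 1) * (Real.exp 1 * νD) / (1 - Real.exp 1 * aw * Θ / κ' ^ 2) ^ 2)) := by
    have hb := towerBase_geomBlockSq_le (t := ε * (1 + (R : ℝ))) (n + 1) hρ' (normV_nonneg hκ'.le hρ'.le hND0) (by rw [mul_assoc]; exact hνD) hθ2i hθΘ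
    have hq : (0 : ℝ) ≤ (1 + ((R' : ℝ) + 1))⁻¹ := by positivity
    calc ρ'⁻¹ ^ (n + 1) * (Real.exp 1 * normV Γ κ' ρ' ND) / (1 - Real.exp 1 * αw * (normV Γ κ' ρ' NV + normV Γ κ' ρ' ND) / κ' ^ 2) ^ 2 * (1 + ((R' : ℝ) + 1))⁻¹
        ≤ ε * (1 + (R : ℝ)) * (ρ'⁻¹ ^ (n + 1) * (Real.exp 1 * νD) / (1 - Real.exp 1 * aw * Θ / κ' ^ 2) ^ 2) * (1 + ((R' : ℝ) + 1))⁻¹ := mul_le_mul_of_nonneg_right hb hq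
      _ = ε * ((1 + (R : ℝ)) / (1 + ((R' : ℝ) + 1)) * (ρ'⁻¹ ^ (n + 1) * (Real.exp 1 * νD) / (1 - Real.exp 1 * aw * Θ / κ' ^ 2) ^ 2)) := by rw [div_eq_mul_inv]; ring
  -- the `Nw` blocks at the two radii
  have hX20 : 0 ≤ normV Γ (κ' + κ + (κ' + κ + (κ' + κ))) ρ₂ Nw := normV_nonneg (by positivity) hρ₂.le hNw0
  have hθ₂i : Real.exp 1 * (α' + α + (m₁' + m₁)) * normV Γ (κ' + κ + (κ' + κ + (κ' + κ))) ρ₂ Nw / (κ' + κ + (κ' + κ + (κ' + κ))) ^ 2 ≤ Real.exp 1 * A * ν₂ / (κ' + κ + (κ' + κ + (κ' + κ))) ^ 2 := by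
    refine div_le_div_of_nonneg_right ?_ (sq_nonneg _)
    calc Real.exp 1 * (α' + α + (m₁' + m₁)) * normV Γ (κ' + κ + (κ' + κ + (κ' + κ))) ρ₂ Nw ≤ Real.exp 1 * (α' + α + (m₁' + m₁)) * (ε * ν₂) := mul_le_mul_of_nonneg_left hν₂ (by positivity)
      _ = Real.exp 1 * (ε * (α' + α + (m₁' + m₁))) * ν₂ := by ring
      _ ≤ Real.exp 1 * A * ν₂ := mul_le_mul_of_nonneg_right (mul_le_mul_of_nonneg_left hAε he0.le) hν₂0
  have hG2 : ∀ j : ℕ, (ρ₂⁻¹ ^ (j) * (Real.exp 1 * normV Γ (κ' + κ + (κ' + κ + (κ' + κ))) ρ₂ Nw) / (1 - Real.exp 1 * (α' + α + (m₁' + m₁)) * normV Γ (κ' + κ + (κ' + κ + (κ' + κ))) ρ₂ Nw / (κ' + κ + (κ' + κ + (κ' + κ))) ^ 2)) ≤ ε * (ρ₂⁻¹ ^ (j) * (Real.exp 1 * ν₂) / (1 - Real.exp 1 * A * ν₂ / (κ' + κ + (κ' + κ + (κ' + κ))) ^ 2)) := fun j => towerBase_geomBlock_le j hρ₂ hX20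 hν₂ hθ₂i hθ₂
  have hG20 : ∀ j : ℕ, 0 ≤ (ρ₂⁻¹ ^ (j) * (Real.exp 1 * ν₂) / (1 - Real.exp 1 * A * ν₂ / (κ' + κ + (κ' + κ + (κ' + κ))) ^ 2)) := fun j => div_nonneg (by positivity) (sub_pos.2 hθ₂).le
  have hG2i0 : ∀ j : ℕ, 0 ≤ (ρ₂⁻¹ ^ (j) * (Real.exp 1 * normV Γ (κ' + κ + (κ' + κ + (κ' + κ))) ρ₂ Nw) / (1 - Real.exp 1 * (α' + α + (m₁' + m₁)) * normV Γ (κ' + κ + (κ' + κ + (κ' + κ))) ρ₂ Nw / (κ' + κ + (κ' + κ + (κ' + κ))) ^ 2)) := fun j => div_nonneg (by positivity) (by linarith)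
  have hXf0 : 0 ≤ normV Γ (κ' + κ) ρf Nw := normV_nonneg (by positivity) hρf.le hNw0
  have hθfi : Real.exp 1 * (α' + α + (m₁' + m₁)) * normV Γ (κ' + κ) ρf Nw / (κ' + κ) ^ 2 ≤ Real.exp 1 * A * νf / (κ' + κ) ^ 2 := by
    refine div_le_div_of_nonneg_right ?_ (sq_nonneg _)
    calc Real.exp 1 * (α' + α + (m₁' + m₁)) * normV Γ (κ' + κ) ρf Nw ≤ Real.exp 1 * (α' + α + (m₁' + m₁)) * (ε * νf) := mul_le_mul_of_nonneg_left hνf (by positivity)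
      _ = Real.exp 1 * (ε * (α' + α + (m₁' + m₁))) * νf := by ring
      _ ≤ Real.exp 1 * A * νf := mul_le_mul_of_nonneg_right (mul_le_mul_of_nonneg_left hAε he0.le) hνf0
  have hGf : ∀ j : ℕ, (ρf⁻¹ ^ (j) * (Real.exp 1 * normV Γ (κ' + κ) ρf Nw) / (1 - Real.exp 1 * (α' + α + (m₁' + m₁)) * normV Γ (κ' + κ) ρf Nw / (κ' + κ) ^ 2)) ≤ ε * (ρf⁻¹ ^ (j) * (Real.exp 1 * νf) / (1 - Real.exp 1 * A * νf / (κ' + κ) ^ 2)) := fun j => towerBase_geomBlock_le j hρf hXf0 hνf hθfi hθf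
  have hGf0 : ∀ j : ℕ, 0 ≤ (ρf⁻¹ ^ (j) * (Real.exp 1 * νf) / (1 - Real.exp 1 * A * νf / (κ' + κ) ^ 2)) := fun j => div_nonneg (by positivity) (sub_pos.2 hθf).le
  have hGfi0 : ∀ j : ℕ, 0 ≤ (ρf⁻¹ ^ (j) * (Real.exp 1 * normV Γ (κ' + κ) ρf Nw) / (1 - Real.exp 1 * (α' + α + (m₁' + m₁)) * normV Γ (κ' + κ) ρf Nw / (κ' + κ) ^ 2)) := fun j => div_nonneg (by positivity) (by linarith)
  -- term 5
  have h5 : ((((n + 1 + 1) * (n + 1 + 2) : ℕ) : ℝ) / 2) * (ρ₂⁻¹ ^ (n + 3) * (Real.exp 1 * normV Γ (κ' + κ + (κ' + κ + (κ' + κ))) ρ₂ Nw) / (1 - Real.exp 1 * (α' + α + (m₁' + m₁)) * normV Γ (κ' + κ + (κ' + κ + (κ' + κ))) ρ₂ Nw / (κ' + κ + (κ' + κ + (κ' + κ))) ^ 2)) * Te ≤ ε * (Te * (((((n + 1 + 1) * (n + 1 + 2) : ℕ) : ℝ) / 2) * (ρ₂⁻¹ ^ (n + 3) * (Real.exp 1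 * ν₂) / (1 - Real.exp 1 * A * ν₂ / (κ' + κ + (κ' + κ + (κ' + κ))) ^ 2)))) :=
    calc ((((n + 1 + 1) * (n + 1 + 2) : ℕ) : ℝ) / 2) * (ρ₂⁻¹ ^ (n + 3) * (Real.exp 1 * normV Γ (κ' + κ + (κ' + κ + (κ' + κ))) ρ₂ Nw) / (1 - Real.exp 1 * (α' + α + (m₁' + m₁)) * normV Γ (κ' + κ + (κ' + κ + (κ' + κ))) ρ₂ Nw / (κ' + κ + (κ' + κ + (κ' + κ))) ^ 2)) * Te ≤ ((((n + 1 + 1) * (n + 1 + 2) : ℕ) : ℝ) / 2) * (ε * (ρ₂⁻¹ ^ (n + 3) * (Real.exp 1 * ν₂) / (1 - Real.exp 1 * A * ν₂ / (κ' + κ + (κ' + κ + (κ' + κ))) ^ 2))) * Te :=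
          mul_le_mul_of_nonneg_right (mul_le_mul_of_nonneg_left (hG2 _) (by positivity)) hTe
      _ = ε * (Te * (((((n + 1 + 1) * (n + 1 + 2) : ℕ) : ℝ) / 2) * (ρ₂⁻¹ ^ (n + 3) * (Real.exp 1 * ν₂) / (1 - Real.exp 1 * A * ν₂ / (κ' + κ + (κ' + κ + (κ' + κ))) ^ 2)))) := by ring
  -- term 6
  have h6 : ‖(2 : ℂ)⁻¹‖ * (∑ a ∈ range (n + 2), ∑ b' ∈ range (n + 2),
      (if a + b' = n + 1 then (((a + 1) * (b' + 1) : ℕ) : ℝ) * (4 * (ρ₂⁻¹ ^ (a + 1) * (Real.exp 1 * normV Γ (κ' + κ + (κ' + κ + (κ' + κ))) ρ₂ Nw) / (1 - Real.exp 1 * (α' + α + (m₁' + m₁)) * normV Γ (κ' + κ + (κ' + κ + (κ' + κ))) ρ₂ Nw / (κ' + κ + (κ' + κ + (κ' + κ))) ^ 2)) * (ρ₂⁻¹ ^ (b' + 1) * (Real.exp 1 * normV Γ (κ' + κ + (κ' + κ + (κ' + κ))) ρ₂ Nw) / (1 - Real.exp 1 * (α' + α + (m₁' + m₁)) * normV Γ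 (κ' + κ + (κ' + κ + (κ' + κ))) ρ₂ Nw / (κ' + κ + (κ' + κ + (κ' + κ))) ^ 2))) else 0)) * T ≤ ε * (tT * (‖(2 : ℂ)⁻¹‖ * ∑ a ∈ range (n + 2), ∑ b' ∈ range (n + 2), (if a + b' = n + 1 then (((a + 1) * (b' + 1) : ℕ) : ℝ) * (4 * (ρ₂⁻¹ ^ (a + 1) * (Real.exp 1 * ν₂) / (1 - Real.exp 1 * A * ν₂ / (κ' + κ + (κ' + κ + (κ' + κ))) ^ 2)) * (ρ₂⁻¹ ^ (b' + 1) * (Real.exp 1 * ν₂) / (1 - Real.exp 1 * A * ν₂ / (κ' + κ + (κ' + κ + (κ' + κ))) ^ 2))) else 0))) := by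
    have hs : ∑ a ∈ range (n + 2), ∑ b' ∈ range (n + 2),
        (if a + b' = n + 1 then (((a + 1) * (b' + 1) : ℕ) : ℝ) * (4 * (ρ₂⁻¹ ^ (a + 1) * (Real.exp 1 * normV Γ (κ' + κ + (κ' + κ + (κ' + κ))) ρ₂ Nw) / (1 - Real.exp 1 * (α' + α + (m₁' + m₁)) * normV Γ (κ' + κ + (κ' + κ + (κ' + κ))) ρ₂ Nw / (κ' + κ + (κ' + κ + (κ' + κ))) ^ 2)) * (ρ₂⁻¹ ^ (b' + 1) * (Real.exp 1 * normV Γ (κ' + κ + (κ' + κ + (κ' + κ))) ρ₂ Nw) / (1 - Real.exp 1 * (α' + α + (m₁' + m₁)) * normV Γ (κ' + κ + (κ' + κ + (κ' + κ))) ρ₂ Nw / (κ' + κ + (κ' + κ + (κ' + κ))) ^ 2))) else 0) ≤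
        ∑ a ∈ range (n + 2), ∑ b' ∈ range (n + 2), ε * ε *
          (if a + b' = n + 1 then (((a + 1) * (b' + 1) : ℕ) : ℝ) * (4 * (ρ₂⁻¹ ^ (a + 1) * (Real.exp 1 * ν₂) / (1 - Real.exp 1 * A * ν₂ / (κ' + κ + (κ' + κ + (κ' + κ))) ^ 2)) * (ρ₂⁻¹ ^ (b' + 1) * (Real.exp 1 * ν₂) / (1 - Real.exp 1 * A * ν₂ / (κ' + κ + (κ' + κ + (κ' + κ))) ^ 2))) else 0) := by
      refine sum_le_sum fun a _ => sum_le_sum fun b' _ => ?_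
      split_ifs
      · have hP : (ρ₂⁻¹ ^ (a + 1) * (Real.exp 1 * normV Γ (κ' + κ + (κ' + κ + (κ' + κ))) ρ₂ Nw) / (1 - Real.exp 1 * (α' + α + (m₁' + m₁)) * normV Γ (κ' + κ + (κ' + κ + (κ' + κ))) ρ₂ Nw / (κ' + κ + (κ' + κ + (κ' + κ))) ^ 2)) * (ρ₂⁻¹ ^ (b' + 1) * (Real.exp 1 * normV Γ (κ' + κ + (κ' + κ + (κ' + κ))) ρ₂ Nw) / (1 - Real.exp 1 * (α' + α + (m₁' + m₁)) * normV Γ (κ' + κ + (κ' + κ + (κ' + κ))) ρ₂ Nw / (κ' + κ + (κ' + κ + (κ' + κ))) ^ 2)) ≤ (ε * (ρ₂⁻¹ ^ (a + 1) * (Real.exp 1 * ν₂) / (1 - Real.exp 1 * A * ν₂ / (κ' + κ + (κ' + κ + (κ' + κ))) ^ 2))) * (ε * (ρ₂⁻¹ ^ (b' + 1) * (Real.exp 1 * ν₂) / (1 - Real.exp 1 * A * ν₂ / (κ' + κ + (κ' + κ + (κ' + κ))) ^ 2))) :=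
          mul_le_mul (hG2 _) (hG2 _) (hG2i0 _) (mul_nonneg hε (hG20 _))
        have hA' : (0 : ℝ) ≤ (((a + 1) * (b' + 1) : ℕ) : ℝ) := by positivity
        calc (((a + 1) * (b' + 1) : ℕ) : ℝ) * (4 * (ρ₂⁻¹ ^ (a + 1) * (Real.exp 1 * normV Γ (κ' + κ + (κ' + κ + (κ' + κ))) ρ₂ Nw) / (1 - Real.exp 1 * (α' + α + (m₁' + m₁)) * normV Γ (κ' + κ + (κ' + κ + (κ' + κ))) ρ₂ Nw / (κ' + κ + (κ' + κ + (κ' + κ))) ^ 2)) * (ρ₂⁻¹ ^ (b' + 1) * (Real.exp 1 * normV Γ (κ' + κ + (κ' + κ + (κ' + κ))) ρ₂ Nw) / (1 - Real.exp 1 * (α' + α + (m₁' + m₁)) * normV Γ (κ' + κ + (κ' + κ + (κ' + κ))) ρ₂ Nw / (κ' + κ + (κ' + κ + (κ' + κ))) ^ 2)))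
            = 4 * ((((a + 1) * (b' + 1) : ℕ) : ℝ) * ((ρ₂⁻¹ ^ (a + 1) * (Real.exp 1 * normV Γ (κ' + κ + (κ' + κ + (κ' + κ))) ρ₂ Nw) / (1 - Real.exp 1 * (α' + α + (m₁' + m₁)) * normV Γ (κ' + κ + (κ' + κ + (κ' + κ))) ρ₂ Nw / (κ' + κ + (κ' + κ + (κ' + κ))) ^ 2)) * (ρ₂⁻¹ ^ (b' + 1) * (Real.exp 1 * normV Γ (κ' + κ + (κ' + κ + (κ' + κ))) ρ₂ Nw) / (1 - Real.exp 1 * (α' + α + (m₁' + m₁)) * normV Γ (κ' + κ + (κ' + κ + (κ' + κ))) ρ₂ Nw / (κ' + κ + (κ' + κ + (κ' + κ))) ^ 2)))) := by ring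
          _ ≤ 4 * ((((a + 1) * (b' + 1) : ℕ) : ℝ) * ((ε * (ρ₂⁻¹ ^ (a + 1) * (Real.exp 1 * ν₂) / (1 - Real.exp 1 * A * ν₂ / (κ' + κ + (κ' + κ + (κ' + κ))) ^ 2))) * (ε * (ρ₂⁻¹ ^ (b' + 1) * (Real.exp 1 * ν₂) / (1 - Real.exp 1 * A * ν₂ / (κ' + κ + (κ' + κ + (κ' + κ))) ^ 2))))) :=
            mul_le_mul_of_nonneg_left (mul_le_mul_of_nonneg_left hP hA') (by norm_num)
          _ = ε * ε * ((((a + 1) * (b' + 1) : ℕ) : ℝ) * (4 * (ρ₂⁻¹ ^ (a + 1) * (Real.exp 1 * ν₂) / (1 - Real.exp 1 * A * ν₂ / (κ' + κ + (κ' + κ + (κ' + κ))) ^ 2)) * (ρ₂⁻¹ ^ (b' + 1) * (Real.exp 1 * ν₂) / (1 - Real.exp 1 * A * ν₂ / (κ' + κ + (κ' + κ + (κ' + κ))) ^ 2)))) := by ring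
      · rw [mul_zero]
    simp_rw [← Finset.mul_sum] at hs
    have hS0 : 0 ≤ ∑ a ∈ range (n + 2), ∑ b' ∈ range (n + 2),
        (if a + b' = n + 1 then (((a + 1) * (b' + 1) : ℕ) : ℝ) * (4 * (ρ₂⁻¹ ^ (a + 1) * (Real.exp 1 * ν₂) / (1 - Real.exp 1 * A * ν₂ / (κ' + κ + (κ' + κ + (κ' + κ))) ^ 2)) * (ρ₂⁻¹ ^ (b' + 1) * (Real.exp 1 * ν₂) / (1 - Real.exp 1 * A * ν₂ / (κ' + κ + (κ' + κ + (κ' + κ))) ^ 2))) else 0) := by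
      refine sum_nonneg fun a _ => sum_nonneg fun b' _ => ?_
      split_ifs
      · exact mul_nonneg (by positivity) (mul_nonneg (mul_nonneg (by norm_num) (hG20 _)) (hG20 _))
      · exact le_rfl
    calc ‖(2 : ℂ)⁻¹‖ * _ * T ≤ ‖(2 : ℂ)⁻¹‖ * (ε * ε * ∑ a ∈ range (n + 2), ∑ b' ∈ range (n + 2),
          (if a + b' = n + 1 then (((a + 1) * (b' + 1) : ℕ) : ℝ) * (4 * (ρ₂⁻¹ ^ (a + 1) * (Real.exp 1 * ν₂) / (1 - Real.exp 1 * A * ν₂ / (κ' + κ + (κ' + κ + (κ' + κ))) ^ 2)) * (ρ₂⁻¹ ^ (b' + 1) * (Real.exp 1 * ν₂) / (1 - Real.exp 1 * A * ν₂ / (κ' + κ + (κ' + κ + (κ' + κ))) ^ 2))) else 0)) * T :=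
        mul_le_mul_of_nonneg_right (mul_le_mul_of_nonneg_left hs (norm_nonneg _)) hT
      _ = ε * ((ε * T) * (‖(2 : ℂ)⁻¹‖ * ∑ a ∈ range (n + 2), ∑ b' ∈ range (n + 2),
          (if a + b' = n + 1 then (((a + 1) * (b' + 1) : ℕ) : ℝ) * (4 * (ρ₂⁻¹ ^ (a + 1) * (Real.exp 1 * ν₂) / (1 - Real.exp 1 * A * ν₂ / (κ' + κ + (κ' + κ + (κ' + κ))) ^ 2)) * (ρ₂⁻¹ ^ (b' + 1) * (Real.exp 1 * ν₂) / (1 - Real.exp 1 * A * ν₂ / (κ' + κ + (κ' + κ + (κ' + κ))) ^ 2))) else 0))) := by ring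
      _ ≤ ε * (tT * (‖(2 : ℂ)⁻¹‖ * ∑ a ∈ range (n + 2), ∑ b' ∈ range (n + 2), (if a + b' = n + 1 then (((a + 1) * (b' + 1) : ℕ) : ℝ) * (4 * (ρ₂⁻¹ ^ (a + 1) * (Real.exp 1 * ν₂) / (1 - Real.exp 1 * A * ν₂ / (κ' + κ + (κ' + κ + (κ' + κ))) ^ 2)) * (ρ₂⁻¹ ^ (b' + 1) * (Real.exp 1 * ν₂) / (1 - Real.exp 1 * A * ν₂ / (κ' + κ + (κ' + κ + (κ' + κ))) ^ 2))) else 0))) := mul_le_mul_of_nonneg_left (mul_le_mul_of_nonneg_right htT (mul_nonneg (norm_nonneg _) hS0)) hε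
  -- term 7
  have h7 : (((((n + 1 + 1) * (n + 1 + 2) : ℕ) : ℝ) / 2) * (s' + s) * (ρf⁻¹ ^ (n + 3) * (Real.exp 1 * normV Γ (κ' + κ) ρf Nw) / (1 - Real.exp 1 * (α' + α + (m₁' + m₁)) * normV Γ (κ' + κ) ρf Nw / (κ' + κ) ^ 2)) + ‖(2 : ℂ)⁻¹‖ * ∑ a ∈ range (n + 2), ∑ b' ∈ range (n + 2),
      (if a + b' = n + 1 then (((a + 1) * (b' + 1) : ℕ) : ℝ) * (2 * (α' + α) * (ρf⁻¹ ^ (a + 1) * (Real.exp 1 * normV Γ (κ' + κ) ρf Nw) / (1 - Real.exp 1 * (α' + α + (m₁' + m₁)) * normV Γ (κ' + κ) ρf Nw / (κ' + κ) ^ 2)) * (ρf⁻¹ ^ (b' + 1) * (Real.exp 1 * normV Γ (κ' + κ) ρf Nw) / (1 - Real.exp 1 * (α' + α + (m₁' + m₁)) * normV Γ (κ' + κ) ρf Nw / (κ' + κ) ^ 2))) else 0)) * ((R' : ℝ) + 1)⁻¹ ≤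
      ε * (((R' : ℝ) + 1)⁻¹ * (((((n + 1 + 1) * (n + 1 + 2) : ℕ) : ℝ) / 2) * (s' + s) * (ρf⁻¹ ^ (n + 3) * (Real.exp 1 * νf) / (1 - Real.exp 1 * A * νf / (κ' + κ) ^ 2)) + ‖(2 : ℂ)⁻¹‖ * ∑ a ∈ range (n + 2), ∑ b' ∈ range (n + 2), (if a + b' = n + 1 then (((a + 1) * (b' + 1) : ℕ) : ℝ) * (2 * A * (ρf⁻¹ ^ (a + 1) * (Real.exp 1 * νf) / (1 - Real.exp 1 * A * νf / (κ' + κ) ^ 2)) * (ρf⁻¹ ^ (b' + 1) * (Real.exp 1 * νf) / (1 - Real.exp 1 * A * νf / (κ' + κ) ^ 2))) else 0))) := by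
    have hs : ∑ a ∈ range (n + 2), ∑ b' ∈ range (n + 2),
        (if a + b' = n + 1 then (((a + 1) * (b' + 1) : ℕ) : ℝ) * (2 * (α' + α) * (ρf⁻¹ ^ (a + 1) * (Real.exp 1 * normV Γ (κ' + κ) ρf Nw) / (1 - Real.exp 1 * (α' + α + (m₁' + m₁)) * normV Γ (κ' + κ) ρf Nw / (κ' + κ) ^ 2)) * (ρf⁻¹ ^ (b' + 1) * (Real.exp 1 * normV Γ (κ' + κ) ρf Nw) / (1 - Real.exp 1 * (α' + α + (m₁' + m₁)) * normV Γ (κ' + κ) ρf Nw / (κ' + κ) ^ 2))) else 0) ≤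
        ∑ a ∈ range (n + 2), ∑ b' ∈ range (n + 2), ε *
          (if a + b' = n + 1 then (((a + 1) * (b' + 1) : ℕ) : ℝ) * (2 * A * (ρf⁻¹ ^ (a + 1) * (Real.exp 1 * νf) / (1 - Real.exp 1 * A * νf / (κ' + κ) ^ 2)) * (ρf⁻¹ ^ (b' + 1) * (Real.exp 1 * νf) / (1 - Real.exp 1 * A * νf / (κ' + κ) ^ 2))) else 0) := by
      refine sum_le_sum fun a _ => sum_le_sum fun b' _ => ?_
      split_ifs
      · have hP : (ρf⁻¹ ^ (a + 1) * (Real.exp 1 * normV Γ (κ' + κ) ρf Nw) / (1 - Real.exp 1 * (α' + α + (m₁' + m₁)) * normV Γ (κ' + κ) ρf Nw / (κ' + κ) ^ 2)) * (ρf⁻¹ ^ (b' + 1) * (Real.exp 1 * normV Γ (κ' + κ) ρf Nw) / (1 - Real.exp 1 * (α' + α + (m₁' + m₁)) * normV Γ (κ' + κ) ρf Nw / (κ' + κ) ^ 2)) ≤ (ε * (ρf⁻¹ ^ (a + 1) * (Real.exp 1 * νf) / (1 - Real.exp 1 * A * νf / (κ' + κ) ^ 2))) * (ε * (ρf⁻¹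 ^ (b' + 1) * (Real.exp 1 * νf) / (1 - Real.exp 1 * A * νf / (κ' + κ) ^ 2))) :=
          mul_le_mul (hGf _) (hGf _) (hGfi0 _) (mul_nonneg hε (hGf0 _))
        have hA' : (0 : ℝ) ≤ (((a + 1) * (b' + 1) : ℕ) : ℝ) * (2 * (α' + α)) := by positivity
        have hGG : 0 ≤ (ρf⁻¹ ^ (a + 1) * (Real.exp 1 * νf) / (1 - Real.exp 1 * A * νf / (κ' + κ) ^ 2)) * (ρf⁻¹ ^ (b' + 1) * (Real.exp 1 * νf) / (1 - Real.exp 1 * A * νf / (κ' + κ) ^ 2)) := mul_nonneg (hGf0 _) (hGf0 _)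
        calc (((a + 1) * (b' + 1) : ℕ) : ℝ) * (2 * (α' + α) * (ρf⁻¹ ^ (a + 1) * (Real.exp 1 * normV Γ (κ' + κ) ρf Nw) / (1 - Real.exp 1 * (α' + α + (m₁' + m₁)) * normV Γ (κ' + κ) ρf Nw / (κ' + κ) ^ 2)) * (ρf⁻¹ ^ (b' + 1) * (Real.exp 1 * normV Γ (κ' + κ) ρf Nw) / (1 - Real.exp 1 * (α' + α + (m₁' + m₁)) * normV Γ (κ' + κ) ρf Nw / (κ' + κ) ^ 2)))
            = (((a + 1) * (b' + 1) : ℕ) : ℝ) * (2 * (α' + α)) * ((ρf⁻¹ ^ (a + 1) * (Real.exp 1 * normV Γ (κ' + κ) ρf Nw) / (1 - Real.exp 1 * (α' + α + (m₁' + m₁)) * normV Γ (κ' + κ) ρf Nw / (κ' + κ) ^ 2)) * (ρf⁻¹ ^ (b' + 1) * (Real.exp 1 * normV Γ (κ' + κ) ρf Nw) / (1 - Real.exp 1 * (α' + α + (m₁' + m₁)) * normV Γ (κ' + κ) ρf Nw / (κ' + κ) ^ 2))) := by ring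
          _ ≤ (((a + 1) * (b' + 1) : ℕ) : ℝ) * (2 * (α' + α)) * ((ε * (ρf⁻¹ ^ (a + 1) * (Real.exp 1 * νf) / (1 - Real.exp 1 * A * νf / (κ' + κ) ^ 2))) * (ε * (ρf⁻¹ ^ (b' + 1) * (Real.exp 1 * νf) / (1 - Real.exp 1 * A * νf / (κ' + κ) ^ 2)))) := mul_le_mul_of_nonneg_left hP hA'
          _ = ε * ((((a + 1) * (b' + 1) : ℕ) : ℝ) * (2 * (ε * (α' + α))) * ((ρf⁻¹ ^ (a + 1) * (Real.exp 1 * νf) / (1 - Real.exp 1 * A * νf / (κ' + κ) ^ 2)) * (ρf⁻¹ ^ (b' + 1) * (Real.exp 1 * νf) / (1 - Real.exp 1 * A * νf / (κ' + κ) ^ 2)))) := by ring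
          _ ≤ ε * ((((a + 1) * (b' + 1) : ℕ) : ℝ) * (2 * A) * ((ρf⁻¹ ^ (a + 1) * (Real.exp 1 * νf) / (1 - Real.exp 1 * A * νf / (κ' + κ) ^ 2)) * (ρf⁻¹ ^ (b' + 1) * (Real.exp 1 * νf) / (1 - Real.exp 1 * A * νf / (κ' + κ) ^ 2)))) :=
            mul_le_mul_of_nonneg_left (mul_le_mul_of_nonneg_right (mul_le_mul_of_nonneg_left
              (mul_le_mul_of_nonneg_left hAα (by norm_num)) (by positivity)) hGG) hε
          _ = ε * ((((a + 1) * (b' + 1) : ℕ) : ℝ) * (2 * A * (ρf⁻¹ ^ (a + 1) * (Real.exp 1 * νf) / (1 - Real.exp 1 * A * νf / (κ' + κ) ^ 2)) * (ρf⁻¹ ^ (b' + 1) * (Real.exp 1 * νf) / (1 - Real.exp 1 * A * νf / (κ' + κ) ^ 2)))) := by ring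
      · rw [mul_zero]
    simp_rw [← Finset.mul_sum] at hs
    have hl : ((((n + 1 + 1) * (n + 1 + 2) : ℕ) : ℝ) / 2) * (s' + s) * (ρf⁻¹ ^ (n + 3) * (Real.exp 1 * normV Γ (κ' + κ) ρf Nw) / (1 - Real.exp 1 * (α' + α + (m₁' + m₁)) * normV Γ (κ' + κ) ρf Nw / (κ' + κ) ^ 2)) ≤ ε * (((((n + 1 + 1) * (n + 1 + 2) : ℕ) : ℝ) / 2) * (s' + s) * (ρf⁻¹ ^ (n + 3) * (Real.exp 1 * νf) / (1 - Real.exp 1 * A * νf / (κ' + κ) ^ 2))) :=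
      calc ((((n + 1 + 1) * (n + 1 + 2) : ℕ) : ℝ) / 2) * (s' + s) * (ρf⁻¹ ^ (n + 3) * (Real.exp 1 * normV Γ (κ' + κ) ρf Nw) / (1 - Real.exp 1 * (α' + α + (m₁' + m₁)) * normV Γ (κ' + κ) ρf Nw / (κ' + κ) ^ 2)) ≤ ((((n + 1 + 1) * (n + 1 + 2) : ℕ) : ℝ) / 2) * (s' + s) * (ε * (ρf⁻¹ ^ (n + 3) * (Real.exp 1 * νf) / (1 - Real.exp 1 * A * νf / (κ' + κ) ^ 2))) := mul_le_mul_of_nonneg_left (hGf _) (by positivity)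
        _ = ε * (((((n + 1 + 1) * (n + 1 + 2) : ℕ) : ℝ) / 2) * (s' + s) * (ρf⁻¹ ^ (n + 3) * (Real.exp 1 * νf) / (1 - Real.exp 1 * A * νf / (κ' + κ) ^ 2))) := by ring
    have hq : (0 : ℝ) ≤ ((R' : ℝ) + 1)⁻¹ := by positivity
    calc _ ≤ (ε * (((((n + 1 + 1) * (n + 1 + 2) : ℕ) : ℝ) / 2) * (s' + s) * (ρf⁻¹ ^ (n + 3) * (Real.exp 1 * νf) / (1 - Real.exp 1 * A * νf / (κ' + κ) ^ 2))) + ‖(2 : ℂ)⁻¹‖ * (ε * ∑ a ∈ range (n + 2), ∑ b' ∈ range (n + 2),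
          (if a + b' = n + 1 then (((a + 1) * (b' + 1) : ℕ) : ℝ) * (2 * A * (ρf⁻¹ ^ (a + 1) * (Real.exp 1 * νf) / (1 - Real.exp 1 * A * νf / (κ' + κ) ^ 2)) * (ρf⁻¹ ^ (b' + 1) * (Real.exp 1 * νf) / (1 - Real.exp 1 * A * νf / (κ' + κ) ^ 2))) else 0))) * ((R' : ℝ) + 1)⁻¹ :=
        mul_le_mul_of_nonneg_right (add_le_add hl (mul_le_mul_of_nonneg_left hs (norm_nonneg _))) hq
      _ = ε * (((R' : ℝ) + 1)⁻¹ * (((((n + 1 + 1) * (n + 1 + 2) : ℕ) : ℝ) / 2) * (s' + s) * (ρf⁻¹ ^ (n + 3) * (Real.exp 1 * νf) / (1 - Real.exp 1 * A * νf / (κ' + κ) ^ 2)) + ‖(2 : ℂ)⁻¹‖ * ∑ a ∈ range (n + 2), ∑ b' ∈ range (n + 2), (if a + b' = n + 1 then (((a + 1) * (b' + 1) : ℕ) : ℝ) * (2 * A * (ρf⁻¹ ^ (a + 1) * (Real.exp 1 * νf) / (1 - Real.exp 1 * A * νf / (κ' + κ) ^ 2)) * (ρf⁻¹ ^ (b'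 + 1) * (Real.exp 1 * νf) / (1 - Real.exp 1 * A * νf / (κ' + κ) ^ 2))) else 0))) := by ring
  -- total
  linarith [h1, h2, h3, h4, h5, h6, h7]

end Summit.HubbardSuperconductivity.HubbardSuperconductivity.Theorems.TwoVolumeSource

end
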